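import Literature.MathematicalPhysics.QuantumFieldTheory.Balaban1983to89.LogChartPolar
import Mathlib.LinearAlgebra.SymplecticGroup

/-!
# (0.9) AND THE LOCAL POLAR FORM ON THE AUTOMORPHISM GROUP OF A BILINEAR FORM; THE THIRD CLASSICAL FAMILY
# `G = Sp(n) ⊂ U(2n)`, `Gᶜ = Sp(2n, ℂ)`, FOR THE TREE'S READER'S MODEL OF «LIE SUBGROUP OF … UNITARY MATRICES»

T. Bałaban, *Renormalization group approach to lattice gauge field theories. I*, Comm. Math. Phys. **109** (1987)
249–301 (`Balaban1987RG1`, "B12"), §0, the standing assumption on the group, pp. 251–252: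

«Field configurations have values in a compact Lie group G. For definitions concerning Lie groups and algebras
see [71]. We assume that G is semisimple and that it is a Lie subgroup of a group of complex unitary matrices,
for example G ⊂ U(N). (In fact a bigger part of our considerations does not depend on the semisimplicity
assumption.)»

p. 252: «Therefore we also consider the complexified group Gᶜ. Elements of this group are defined as matrices of
the form 𝐔 = U′U, where U ∈ G and U′ = exp iA′, A′ ∈ 𝐠ᶜ, 𝐠ᶜ is the complexification of the real Lie algebra 𝐠.»;
p. 253: the average is «a Gᶜ-valued function defined on sets {𝐔_j : j = 1, 2, ..., n}, 𝐔_j ∈ Gᶜ, with sufficiently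
small diameters» and «if 𝐔_j ∈ G, then M({𝐔_j}) ∈ G also. (0.9)».

## What this file PROVES (nothing printed is asserted; every statement is about the tree's constructions)

The module `BlockAveragingFederbushGValued` carries print's «Lie subgroup of a group of complex unitary matrices»
as DATA — a log-charted closed subgroup `LogChart` (closed `G ∋ 1` closed under products, a real subspace `𝔤`, a
radius `ρ`, `exp 𝔤 ⊆ G`, `log (G ∩ B_ρ(1)) ⊆ 𝔤`) — proves (0.9) for the tree's solution `fedSol` of (0.10) and the
group average `fedM δ` on EVERY such chart, and INSTANCES the chart for `U(N)`, `SU(N)`, `SL(N, ℂ)` (v1) and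
`O(N)`, `SO(N)`, `O(N, ℂ)`, `SO(N, ℂ)` and the real chart `realLogChart` (v1.1); `LogChartPolar` gives print's local form
`𝐔 = U′U` on every `star`-closed chart.  THIS FILE adds, by one uniform argument,

* §1–§2 **THE AUTOMORPHISM GROUP `Aut(J) = {g : g J gᵀ = J}` OF AN ARBITRARY BILINEAR FORM `J ∈ M_N(ℂ)` IS
  LOG-CHARTED** (`formLogChart J`; Lie algebra `𝔞𝔲𝔱(J) = {X : X J + J Xᵀ = 0}`, a COMPLEX subspace
  (`smul_mem_formSkew`); `ρ = 1/3`).  Exponential side: the intertwining `A J = J B ⟹ e^{A} J = J e^{B}`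
  (`exp_mul_eq_mul_exp_of_mul_eq`, termwise in the exponential series), whence `e^{X} J (e^{X})ᵀ = e^{X} J e^{Xᵀ} =
  e^{X} e^{−X} J = J` (Mathlib `Matrix.exp_transpose`).  Logarithmic side (`mlog_mul_eq_neg_mul_transpose`): for
  `g ∈ Aut(J)` with `‖g − 1‖ ≤ 1/3`, `g J = J (g⁻¹)ᵀ` intertwines the series (21) of `g` with that of `(g⁻¹)ᵀ`, so
  `(log g) J = J (log (g⁻¹)ᵀ) = J (log g⁻¹)ᵀ = −J (log g)ᵀ` (the tree's `hasSum_mlog_transpose`, `mlog_inv`) — NO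
  hypothesis on `J` (invertible or not).  `Aut(J)` is closed under `star` whenever `J̄ J = c·1`, `c ≠ 0`
  (`star_mem_formLogChart`: `(ḡ J̄)(ḡᵀ J) = c·1` is a scalar, so the two factors commute).  `J = 1` recovers the
  v1.1 complex orthogonal chart (`formLogChart_one_carrier`, `formLogChart_one_lie`).
* §3 **INSTANCES: THE SYMPLECTIC FAMILY.**  `symplecticLogChart l` := `formLogChart (Matrix.J l ℂ)` on
  `M_{2n}(ℂ)` (`2n = |l ⊕ l|`), whose carrier is MATHLIB'S `Matrix.symplecticGroup l ℂ = Sp(2n, ℂ)`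
  (`mem_symplecticLogChart_carrier`), `star`-closed (`star_mem_symplecticGroup`; `J̄ = J`, `J² = −1`, so `c = −1`);
  and the COMPACT SYMPLECTIC GROUP `Sp(n) = USp(2n) = U(2n) ∩ Sp(2n, ℂ)` (`compactSymplecticLogChart l` :=
  `unitaryLogChart ⊓ symplecticLogChart`, Lie algebra `𝔰𝔭(n) = 𝔲(2n) ∩ 𝔰𝔭(2n, ℂ)`, `ρ = 1/3`) — the third classical
  family of compact groups `G ⊂ U(N)` of print's «for example», next to the tree's unitary and orthogonal families.
  Non-vacuity: `J ∈ Sp(n)` (`J_mem_compactSymplecticLogChart`; Mathlib `SymplecticGroup.J_mem`, `J J* = −J² = 1`).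
* §4 **(0.9) FOR THE TREE'S CONSTRUCTIONS ON `Aut(J)`, `Sp(2n, ℂ)`, `Sp(n)`** (GValued §4/§4b BY NAME):
  `fedSol W ∈ Aut(J)` for `Aut(J)`-families of radius `δ ≤ 1/100` and any `J` (`fedSol_mem_formAut_of_chart`);
  `fedM δ U ∈ Aut(J)` in the `star`-closed case (`fedM_mem_formAut_of_chart`); `fedSol W`, `fedM δ U ∈ Sp(2n, ℂ)`
  (`fedSol_mem_symplecticGroup_of_chart`, `fedM_mem_symplecticGroup_of_chart`) and `∈ Sp(n)`
  (`fedSol_mem_compactSymplectic_of_chart`, `fedM_mem_compactSymplectic_of_chart`) for such families.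
* §5 **THE LOCAL POLAR ∕ CARTAN FORM** (`LogChartPolar` §2/§4a BY NAME): for `𝐔 ∈ Aut(J)` (`star`-closed case),
  `‖𝐔 − 1‖ ≤ 1/10`: `U = e^{−P/2}𝐔 ∈ Aut(J) ∩ U(N)`, `U′ = e^{P/2} ∈ Aut(J)`, `A′ = −(i/2)P ∈ 𝔞𝔲𝔱(J) ∩ 𝔲(N)`
  (`polarUnit_mem_formAut`); for `𝐔 ∈ Sp(2n, ℂ)`: `U ∈ Sp(n)`, `U′ ∈ Sp(2n, ℂ)`, `A′ ∈ 𝔰𝔭(n)`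
  (`polarUnit_mem_compactSymplectic`, `exists_polar_symplectic`) — print's «𝐔 = U′U, where U ∈ G and
  U′ = exp iA′» for `G = Sp(n)` and the tree's equation-defined `Gᶜ = Sp(2n, ℂ)`, near the identity.

## What is NOT encoded

* That `Sp(2n, ℂ)` IS the complexification of `Sp(n)` in print's sense (`Gᶜ = exp(i𝔤)·G` globally), or that
  `𝔰𝔭(2n, ℂ) = 𝔰𝔭(n) ⊕ i𝔰𝔭(n)`: only the local product form of §5 at radius `1/10` and the equation-defined groups.
* Semisimplicity, connectedness, or any structure theory of `G`; Cartan's closed-subgroup theorem (which would make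
  every closed `G ⊂ U(N)` log-charted) is not available — the charts are INSTANCED, never assumed
  (`BlockAveragingFederbushGValued`, «NOT encoded»).  Exceptional compact groups are not instanced.
* The radius `1/3` and the constants are the FILE's; print has «sufficiently small diameters» only.

Model conventions: everything here is `[folklore]` (matrix Lie groups defined by one quadratic equation; the
exponential and logarithmic series); the (0.9) corollaries carry the cite tag of the GValued module's theorem they
instantiate; the quotations above are context, not claims.  `J` is Mathlib's `Matrix.J l ℂ = [[0, −1], [1, 0]]` in
`l ⊕ l` block form, and `Sp(2n, ℂ)` is Mathlib's `Matrix.symplecticGroup l ℂ = {A : A J Aᵀ = J}`.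
-/

open NormedSpace Metric Set Filter Topology

namespace Literature.MathematicalPhysics.QuantumFieldTheory.Balaban1983to89

open MatrixLog
open scoped Matrix.Norms.L2Operator

variable {n : Type*} [Fintype n] [DecidableEq n]

/-! ## §1 Intertwining of the exponential series and of the logarithmic series (21) -/

/-- **INTERTWINING OF THE EXPONENTIAL**: `A J = J B ⟹ e^{A} J = J e^{B}` (termwise `A^k J = J B^k` in the
exponential series). [folklore] -/
theorem exp_mul_eq_mul_exp_of_mul_eq {A B J : Matrix n n ℂ} (h : A * J = J * B) : exp A * J = J * exp B := by
  have hA := (NormedSpace.exp_series_hasSum_exp' (𝕂 := ℂ) A).mul_right J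
  have hB := (NormedSpace.exp_series_hasSum_exp' (𝕂 := ℂ) B).mul_left J
  have hs : SemiconjBy J B A := h.symm
  have heq : (fun k : ℕ => ((k.factorial : ℂ)⁻¹ • A ^ k) * J) =
      fun k : ℕ => J * ((k.factorial : ℂ)⁻¹ • B ^ k) := by
    funext k
    rw [smul_mul_assoc, mul_smul_comm, ← (hs.pow_right k).eq]
  rw [heq] at hA
  exact hA.unique hB

/-- A matrix in the domain of (21) is invertible (`g = e^{log g}`). [folklore] -/
theorem isUnit_of_norm_sub_one_lt_one {g : Matrix n n ℂ} (hg : ‖g - 1‖ < 1) : IsUnit g := by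
  rw [← exp_mlog hg]; exact isUnit_exp_matrix _

/-- **INTERTWINING OF THE LOGARITHM ON THE AUTOMORPHISM GROUP OF A BILINEAR FORM**: `g J gᵀ = J`,
`‖g − 1‖ ≤ 1/3` ⟹ `(log g) J = −J (log g)ᵀ` (`g J = J (g⁻¹)ᵀ` intertwines the series (21) of `g` and of `(g⁻¹)ᵀ`
termwise; `log (g⁻¹)ᵀ = (log g⁻¹)ᵀ = −(log g)ᵀ` by the tree's `hasSum_mlog_transpose`, `mlog_inv`).  No hypothesis on
`J`. [folklore] -/
theorem mlog_mul_eq_neg_mul_transpose {g J : Matrix n n ℂ} (hgJ : g * J * g.transpose = J)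
    (hg : ‖g - 1‖ ≤ 1 / 3) : mlog g * J = -(J * (mlog g).transpose) := by
  have hg1 : ‖g - 1‖ < 1 := by linarith
  have hdet : IsUnit g.det := (Matrix.isUnit_iff_isUnit_det _).1 (isUnit_of_norm_sub_one_lt_one hg1)
  have h1 : g⁻¹ * g = 1 := Matrix.nonsing_inv_mul _ hdet
  have hsemi : g * J = J * (g⁻¹).transpose := by
    have ht : g.transpose * (g⁻¹).transpose = 1 := by
      rw [← Matrix.transpose_mul, h1, Matrix.transpose_one]
    calc g * J = g * J * (g.transpose * (g⁻¹).transpose) := by rw [ht, Matrix.mul_one]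
      _ = g * J * g.transpose * (g⁻¹).transpose := by simp only [Matrix.mul_assoc]
      _ = J * (g⁻¹).transpose := by rw [hgJ]
  have hs : SemiconjBy J ((g⁻¹).transpose - 1) (g - 1) := by
    show J * ((g⁻¹).transpose - 1) = (g - 1) * J
    rw [mul_sub, sub_mul, mul_one, one_mul, hsemi]
  have s1 := (hasSum_mlog hg1).mul_right J
  have s2 := (hasSum_mlog_transpose (norm_inv_sub_one_lt_one hg)).mul_left J
  have heq : (fun k : ℕ => (Literature.Analysis.Complex.logSeriesCoeff k • (g - 1) ^ k) * J) =
      fun k : ℕ => J * (Literature.Analysis.Complex.logSeriesCoeff k • ((g⁻¹).transpose - 1) ^ k) := by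
    funext k
    rw [smul_mul_assoc, mul_smul_comm, ← (hs.pow_right k).eq]
  rw [heq] at s1
  rw [s1.unique s2, mlog_inv hg, Matrix.transpose_neg, mul_neg]

/-! ## §2 The automorphism group `Aut(J) = {g : g J gᵀ = J}` of a bilinear form is log-charted -/

/-- The Lie algebra `𝔞𝔲𝔱(J) = {X : X J + J Xᵀ = 0}` of the form `J`, as a real-linear subspace. [folklore] -/
def formSkew (J : Matrix n n ℂ) : Submodule ℝ (Matrix n n ℂ) where
  carrier := {X | X * J + J * X.transpose = 0}
  add_mem' := fun {a b} (ha : a * J + J * a.transpose = 0) (hb : b * J + J * b.transpose = 0) => by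
    show (a + b) * J + J * (a + b).transpose = 0
    rw [Matrix.transpose_add, add_mul, mul_add, add_add_add_comm, ha, hb, add_zero]
  zero_mem' := by
    show (0 : Matrix n n ℂ) * J + J * (0 : Matrix n n ℂ).transpose = 0
    simp
  smul_mem' := fun c a (ha : a * J + J * a.transpose = 0) => by
    show (c • a) * J + J * (c • a).transpose = 0
    rw [Matrix.transpose_smul, smul_mul_assoc, mul_smul_comm, ← smul_add, ha, smul_zero]

/-- Membership in `formSkew J`: `X J + J Xᵀ = 0`. [folklore] -/
@[simp] theorem mem_formSkew {J X : Matrix n n ℂ} : X ∈ formSkew J ↔ X * J + J * X.transpose = 0 := Iff.rfl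

/-- `formSkew J` is a COMPLEX subspace: closed under complex scalars (print's `𝐠ᶜ`). [folklore] -/
theorem smul_mem_formSkew {J X : Matrix n n ℂ} (c : ℂ) (hX : X ∈ formSkew J) : c • X ∈ formSkew J := by
  rw [mem_formSkew] at hX ⊢
  rw [Matrix.transpose_smul, smul_mul_assoc, mul_smul_comm, ← smul_add, hX, smul_zero]

/-- **THE AUTOMORPHISM GROUP `Aut(J) = {g : g J gᵀ = J}` OF AN ARBITRARY BILINEAR FORM `J` ON `ℂ^N` IS
LOG-CHARTED**, Lie algebra `{X : X J + J Xᵀ = 0}`, `ρ = 1/3`: `X J = J(−Xᵀ)` gives `e^{X} J e^{Xᵀ} = e^{X} e^{−X} J = J`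
(`exp_mul_eq_mul_exp_of_mul_eq`, Mathlib `Matrix.exp_transpose`), and `(log g) J + J (log g)ᵀ = 0`
(`mlog_mul_eq_neg_mul_transpose`).  Instances: `J = 1` (the v1.1 complex orthogonal group, `formLogChart_one_carrier`),
`J` = Mathlib's `Matrix.J l ℂ` (the symplectic group `Sp(2n, ℂ)`, `symplecticLogChart`). [folklore] -/
noncomputable def formLogChart (J : Matrix n n ℂ) : LogChart (Matrix n n ℂ) where
  carrier := {A | A * J * A.transpose = J}
  lie := formSkew J
  ρ := 1 / 3
  ρ_pos := by norm_num
  one_mem := by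
    show (1 : Matrix n n ℂ) * J * (1 : Matrix n n ℂ).transpose = J
    simp
  mul_mem := fun a b (ha : a * J * a.transpose = J) (hb : b * J * b.transpose = J) => by
    show a * b * J * (a * b).transpose = J
    rw [Matrix.transpose_mul]
    calc a * b * J * (b.transpose * a.transpose) = a * (b * J * b.transpose) * a.transpose := by
          simp only [Matrix.mul_assoc]
      _ = J := by rw [hb, ha]
  isClosed := isClosed_eq ((continuous_id.mul continuous_const).mul continuous_id.matrix_transpose)
    continuous_const
  exp_mem := fun X (hX : X * J + J * X.transpose = 0) => by
    letI : NormedAlgebra ℚ (Matrix n n ℂ) := NormedAlgebra.restrictScalars ℚ ℂ _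
    show exp X * J * (exp X).transpose = J
    have h : (-X) * J = J * X.transpose := by
      rw [neg_mul, eq_comm, ← sub_eq_zero, sub_neg_eq_add, add_comm, hX]
    rw [← Matrix.exp_transpose, Matrix.mul_assoc, ← exp_mul_eq_mul_exp_of_mul_eq h, ← Matrix.mul_assoc,
      ← exp_add_of_commute (Commute.refl X).neg_right, add_neg_cancel, exp_zero, Matrix.one_mul]
  mlog_mem := fun g (hg : g * J * g.transpose = J) hs => by
    show mlog g * J + J * (mlog g).transpose = 0
    rw [mlog_mul_eq_neg_mul_transpose hg hs, neg_add_cancel]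

/-- Membership in the `Aut(J)` chart: `A J Aᵀ = J`. [folklore] -/
@[simp] theorem mem_formLogChart_carrier {J A : Matrix n n ℂ} :
    A ∈ (formLogChart J).carrier ↔ A * J * A.transpose = J := Iff.rfl

/-- The Lie algebra of the `Aut(J)` chart: `X J + J Xᵀ = 0`. [folklore] -/
@[simp] theorem mem_formLogChart_lie {J X : Matrix n n ℂ} :
    X ∈ (formLogChart J).lie ↔ X * J + J * X.transpose = 0 := Iff.rfl

/-- The radius of the `Aut(J)` chart is `1/3`. [folklore] -/
@[simp] theorem formLogChart_ρ {J : Matrix n n ℂ} : (formLogChart J).ρ = 1 / 3 := rfl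

/-- The Lie algebra of the `Aut(J)` chart is closed under `i` (needed for the Cartan form). [folklore] -/
theorem I_smul_mem_formLogChart_lie {J X : Matrix n n ℂ} (hX : X ∈ (formLogChart J).lie) :
    Complex.I • X ∈ (formLogChart J).lie :=
  smul_mem_formSkew Complex.I hX

/-- `J = 1`: the `Aut(1)` chart has the carrier of the v1.1 complex orthogonal chart `O(N, ℂ) = {gᵀ g = 1}`
(`g gᵀ = 1 ⟺ gᵀ g = 1`). [folklore] -/
theorem formLogChart_one_carrier :
    (formLogChart (1 : Matrix n n ℂ)).carrier = (complexOrthogonalLogChart n).carrier := by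
  ext A
  rw [mem_formLogChart_carrier, mem_complexOrthogonalLogChart_carrier, Matrix.mul_one, mul_eq_one_comm]

/-- `J = 1`: the Lie algebras agree too (`X + Xᵀ = 0 ⟺ Xᵀ = −X`). [folklore] -/
theorem formLogChart_one_lie :
    (formLogChart (1 : Matrix n n ℂ)).lie = (complexOrthogonalLogChart n).lie := by
  ext X
  rw [mem_formLogChart_lie, mem_complexOrthogonalLogChart_lie, Matrix.mul_one, Matrix.one_mul, add_comm,
    add_eq_zero_iff_eq_neg]

/-- Entrywise conjugation commutes with transposition. [folklore] -/
theorem conjEntry_transpose (A : Matrix n n ℂ) : conjEntry n A.transpose = (conjEntry n A).transpose := by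
  rw [conjEntry_apply, conjEntry_apply, Matrix.transpose_map]

/-- `g* = (ḡ)ᵀ`. [folklore] -/
theorem star_eq_transpose_conjEntry (A : Matrix n n ℂ) : star A = (conjEntry n A).transpose := by
  rw [← transpose_star_eq_conjEntry, Matrix.transpose_transpose]

/-- **`Aut(J)` IS CLOSED UNDER `star` WHEN `J̄ J = c·1`, `c ≠ 0`** (e.g. `J = 1`, `c = 1`; the symplectic
`J`, `c = −1`; any real `J` with `J² = ±1`): from `g J gᵀ = J`, `ḡ J̄ ḡᵀ = J̄`, and `(ḡ J̄)(ḡᵀ J) = J̄ J = c·1` is a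
scalar, so the factors commute: `ḡᵀ J ḡ J̄ = c·1`, i.e. `ḡᵀ J ḡ = J`, i.e. `g* J (g*)ᵀ = J`. [folklore] -/
theorem star_mem_formLogChart {J g : Matrix n n ℂ} {c : ℂ} (hc : c ≠ 0)
    (hJ : conjEntry n J * J = c • (1 : Matrix n n ℂ)) (hg : g ∈ (formLogChart J).carrier) :
    star g ∈ (formLogChart J).carrier := by
  rw [mem_formLogChart_carrier] at hg ⊢
  rw [star_eq_transpose_conjEntry, Matrix.transpose_transpose]
  set h := conjEntry n g with hh
  have E : h * conjEntry n J * h.transpose = conjEntry n J := by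
    have := congrArg (conjEntry n) hg
    rwa [map_mul, map_mul, conjEntry_transpose] at this
  have P : (h * conjEntry n J) * (h.transpose * J) = c • 1 := by
    calc (h * conjEntry n J) * (h.transpose * J) = h * conjEntry n J * h.transpose * J := by
          simp only [Matrix.mul_assoc]
      _ = c • 1 := by rw [E, hJ]
  have P' : (h.transpose * J) * (h * conjEntry n J) = c • 1 := by
    have Q : (c⁻¹ • (h * conjEntry n J)) * (h.transpose * J) = 1 := by
      rw [smul_mul_assoc, P, smul_smul, inv_mul_cancel₀ hc, one_smul]
    have Q' := mul_eq_one_comm.1 Q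
    rw [mul_smul_comm] at Q'
    have := congrArg (fun M : Matrix n n ℂ => c • M) Q'
    simpa only [smul_smul, mul_inv_cancel₀ hc, one_smul] using this
  have R : c • (h.transpose * J * h) = c • J := by
    calc c • (h.transpose * J * h) = h.transpose * J * h * (c • (1 : Matrix n n ℂ)) := by
          rw [mul_smul_comm, Matrix.mul_one]
      _ = h.transpose * J * h * (conjEntry n J * J) := by rw [hJ]
      _ = (h.transpose * J) * (h * conjEntry n J) * J := by simp only [Matrix.mul_assoc]
      _ = c • J := by rw [P', smul_mul_assoc, Matrix.one_mul]
  exact smul_right_injective _ hc R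

/-! ## §3 Instances: the symplectic group `Sp(2n, ℂ)` (Mathlib's `Matrix.symplecticGroup`) and the compact
symplectic group `Sp(n) = U(2n) ∩ Sp(2n, ℂ)` -/

section Symplectic

variable {l : Type*} [Fintype l] [DecidableEq l]

/-- **THE COMPLEX SYMPLECTIC GROUP `Sp(2n, ℂ) = {A : A J Aᵀ = J}` IS LOG-CHARTED** (`J` = Mathlib's `Matrix.J l ℂ`,
the chart `formLogChart J`; its carrier is Mathlib's `Matrix.symplecticGroup l ℂ`) — for `G = Sp(n)` the tree's
equation-defined candidate for print's `Gᶜ` of p. 252 (see «NOT encoded»). [folklore] -/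
noncomputable def symplecticLogChart (l : Type*) [Fintype l] [DecidableEq l] :
    LogChart (Matrix (l ⊕ l) (l ⊕ l) ℂ) :=
  formLogChart (Matrix.J l ℂ)

/-- The carrier of the symplectic chart is Mathlib's symplectic group. [folklore] -/
@[simp] theorem mem_symplecticLogChart_carrier {A : Matrix (l ⊕ l) (l ⊕ l) ℂ} :
    A ∈ (symplecticLogChart l).carrier ↔ A ∈ Matrix.symplecticGroup l ℂ :=
  SymplecticGroup.mem_iff.symm

/-- The Lie algebra of the symplectic chart: `𝔰𝔭(2n, ℂ) = {X : X J + J Xᵀ = 0}`. [folklore] -/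
@[simp] theorem mem_symplecticLogChart_lie {X : Matrix (l ⊕ l) (l ⊕ l) ℂ} :
    X ∈ (symplecticLogChart l).lie ↔ X * Matrix.J l ℂ + Matrix.J l ℂ * X.transpose = 0 := Iff.rfl

/-- The radius of the symplectic chart is `1/3`. [folklore] -/
@[simp] theorem symplecticLogChart_ρ : (symplecticLogChart l).ρ = 1 / 3 := rfl

/-- `J̄ = J` (the entries of `J` are `0, ±1`; Mathlib `Matrix.map_J`). [folklore] -/
theorem conjEntry_J : conjEntry (l ⊕ l) (Matrix.J l ℂ) = Matrix.J l ℂ :=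
  Matrix.map_J l (starRingEnd ℂ)

/-- `J̄ J = (−1)·1`. [folklore] -/
theorem conjEntry_J_mul_J : conjEntry (l ⊕ l) (Matrix.J l ℂ) * Matrix.J l ℂ = (-1 : ℂ) • (1 : Matrix _ _ ℂ) := by
  rw [conjEntry_J, Matrix.J_squared, neg_one_smul]

/-- **`Sp(2n, ℂ)` IS CLOSED UNDER `star`** (`star_mem_formLogChart` with `c = −1`; equivalently Mathlib's
`SymplecticGroup.map_mem` + `transpose_mem`). [folklore] -/
theorem star_mem_symplecticGroup {g : Matrix (l ⊕ l) (l ⊕ l) ℂ} (hg : g ∈ Matrix.symplecticGroup l ℂ) :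
    star g ∈ Matrix.symplecticGroup l ℂ :=
  mem_symplecticLogChart_carrier.1
    (star_mem_formLogChart (by norm_num) conjEntry_J_mul_J (mem_symplecticLogChart_carrier.2 hg))

/-- **THE COMPACT SYMPLECTIC GROUP `Sp(n) = USp(2n) = U(2n) ∩ Sp(2n, ℂ)` IS LOG-CHARTED** (intersection of the
`U(2n)` chart of `BlockAveragingFederbushGValued` and the symplectic chart; `ρ = 1/3`): the third classical family
of print's «compact Lie group G … a Lie subgroup of a group of complex unitary matrices, for example G ⊂ U(N)»
(pp. 251–252), next to the tree's `U(N)`, `SU(N)` (v1 of the `GValued` module) and `O(N)`, `SO(N)` (its v1.1).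
[folklore] -/
noncomputable def compactSymplecticLogChart (l : Type*) [Fintype l] [DecidableEq l] :
    LogChart (Matrix (l ⊕ l) (l ⊕ l) ℂ) :=
  (unitaryLogChart (l ⊕ l)).inf (symplecticLogChart l)

/-- Membership in the `Sp(n)` chart: unitary and symplectic. [folklore] -/
@[simp] theorem mem_compactSymplecticLogChart_carrier {A : Matrix (l ⊕ l) (l ⊕ l) ℂ} :
    A ∈ (compactSymplecticLogChart l).carrier ↔
      A ∈ Matrix.unitaryGroup (l ⊕ l) ℂ ∧ A ∈ Matrix.symplecticGroup l ℂ := by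
  show A ∈ (unitaryLogChart (l ⊕ l)).carrier ∩ (symplecticLogChart l).carrier ↔ _
  rw [Set.mem_inter_iff, unitaryLogChart_carrier, mem_symplecticLogChart_carrier]
  rfl

/-- The Lie algebra of the `Sp(n)` chart: `𝔰𝔭(n) = 𝔲(2n) ∩ 𝔰𝔭(2n, ℂ)` (`X* = −X` and `X J + J Xᵀ = 0`). [folklore] -/
@[simp] theorem mem_compactSymplecticLogChart_lie {X : Matrix (l ⊕ l) (l ⊕ l) ℂ} :
    X ∈ (compactSymplecticLogChart l).lie ↔ star X = -X ∧ X * Matrix.J l ℂ + Matrix.J l ℂ * X.transpose = 0 := by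
  show X ∈ (unitaryLogChart (l ⊕ l)).lie ⊓ (symplecticLogChart l).lie ↔ _
  rw [Submodule.mem_inf, mem_unitaryLogChart_lie, mem_symplecticLogChart_lie]

/-- The radius of the `Sp(n)` chart is `1/3`. [folklore] -/
@[simp] theorem compactSymplecticLogChart_ρ : (compactSymplecticLogChart l).ρ = 1 / 3 := by
  show min (unitaryLogChart (l ⊕ l)).ρ (symplecticLogChart l).ρ = 1 / 3
  rw [unitaryLogChart_ρ, symplecticLogChart_ρ, min_self]

/-- `Sp(n)` is closed under `star` (both factors are). [folklore] -/
theorem star_mem_compactSymplecticLogChart {g : Matrix (l ⊕ l) (l ⊕ l) ℂ}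
    (hg : g ∈ (compactSymplecticLogChart l).carrier) : star g ∈ (compactSymplecticLogChart l).carrier := by
  rw [mem_compactSymplecticLogChart_carrier] at hg ⊢
  exact ⟨Unitary.star_mem hg.1, star_mem_symplecticGroup hg.2⟩

/-- `J* = −J` (`J` is real and `Jᵀ = −J`). [folklore] -/
theorem star_J : star (Matrix.J l ℂ) = -Matrix.J l ℂ := by
  rw [star_eq_transpose_conjEntry, conjEntry_J, Matrix.J_transpose]

/-- **NON-VACUITY: `J ∈ Sp(n)`** (`J J* = −J² = 1`; Mathlib `SymplecticGroup.J_mem`). [folklore] -/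
theorem J_mem_compactSymplecticLogChart : Matrix.J l ℂ ∈ (compactSymplecticLogChart l).carrier := by
  rw [mem_compactSymplecticLogChart_carrier, Matrix.mem_unitaryGroup_iff, star_J, mul_neg, Matrix.J_squared,
    neg_neg]
  exact ⟨rfl, SymplecticGroup.J_mem l ℂ⟩

end Symplectic

/-! ## §4 (0.9) for the tree's constructions on `Aut(J)`, `Sp(2n, ℂ)`, `Sp(n)` -/

namespace FederbushMean

section FormCorollaries

variable {ι : Type*} [Fintype ι] [Nonempty ι]
variable {m : ℕ} {δ : ℝ}

/-- **(0.9) on `Aut(J)`** for Federbush's solution of (0.10): `(fedSol W) J (fedSol W)ᵀ = J` for `Aut(J)`-valued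
families of radius `δ ≤ 1/100` (GValued §4 `fedSol_mem_logChart` on `formLogChart J`; any `J`).
[cite: Balaban1987RG1, (0.9) p.253] -/
theorem fedSol_mem_formAut_of_chart {J : Matrix n n ℂ} (hδ : δ ≤ 1 / 100) {W : ι → Matrix n n ℂ}
    (hWJ : ∀ j, W j * J * (W j).transpose = J) (hW : ∀ j, ‖W j - 1‖ ≤ δ) :
    fedSol W * J * (fedSol W).transpose = J :=
  (mem_formLogChart_carrier).1
    (fedSol_mem_logChart (formLogChart J) hδ (by rw [formLogChart_ρ]; linarith) hW hWJ)

/-- **(0.9) on `Aut(J)` for the group average `fedM δ`** when `Aut(J)` is `star`-closed (`J̄ J = c·1`, `c ≠ 0`):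
`fedM δ U ∈ Aut(J)` for `Aut(J)`-valued matrix families, `δ ≤ 1/100` (GValued §4b `fedM_mem_logChart`).
[cite: Balaban1987RG1, (0.9) p.253] -/
theorem fedM_mem_formAut_of_chart {J : Matrix n n ℂ} {c : ℂ} (hc : c ≠ 0)
    (hJ : conjEntry n J * J = c • (1 : Matrix n n ℂ)) {U : Fin (m + 1) → Matrix n n ℂ}
    (hU : ∀ j, U j * J * (U j).transpose = J) (hδ : δ ≤ 1 / 100) : fedM δ U * J * (fedM δ U).transpose = J :=
  (mem_formLogChart_carrier).1 (fedM_mem_logChart (formLogChart J) (fun _ hg => star_mem_formLogChart hc hJ hg)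
    (fun j => (mem_formLogChart_carrier).2 (hU j)) hδ (by rw [formLogChart_ρ]; linarith))

variable {l : Type*} [Fintype l] [DecidableEq l]

/-- **(0.9) on `Sp(2n, ℂ) = Sp(n)ᶜ`**: `fedSol W ∈ Sp(2n, ℂ)` for symplectic families of radius `δ ≤ 1/100` (print
p. 253: `M` is «a Gᶜ-valued function»). [cite: Balaban1987RG1, (0.9) p.253] -/
theorem fedSol_mem_symplecticGroup_of_chart (hδ : δ ≤ 1 / 100) {W : ι → Matrix (l ⊕ l) (l ⊕ l) ℂ}
    (hWs : ∀ j, W j ∈ Matrix.symplecticGroup l ℂ) (hW : ∀ j, ‖W j - 1‖ ≤ δ) :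
    fedSol W ∈ Matrix.symplecticGroup l ℂ :=
  mem_symplecticLogChart_carrier.1 (fedSol_mem_logChart (symplecticLogChart l) hδ
    (by rw [symplecticLogChart_ρ]; linarith) hW (fun j => mem_symplecticLogChart_carrier.2 (hWs j)))

/-- **(0.9) for the group average on `Sp(2n, ℂ)`**: `fedM δ U ∈ Sp(2n, ℂ)` for symplectic matrix families,
`δ ≤ 1/100`. [cite: Balaban1987RG1, (0.9) p.253] -/
theorem fedM_mem_symplecticGroup_of_chart {U : Fin (m + 1) → Matrix (l ⊕ l) (l ⊕ l) ℂ}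
    (hU : ∀ j, U j ∈ Matrix.symplecticGroup l ℂ) (hδ : δ ≤ 1 / 100) : fedM δ U ∈ Matrix.symplecticGroup l ℂ :=
  mem_symplecticLogChart_carrier.1 (fedM_mem_logChart (symplecticLogChart l)
    (fun _ hg => mem_symplecticLogChart_carrier.2 (star_mem_symplecticGroup (mem_symplecticLogChart_carrier.1 hg)))
    (fun j => mem_symplecticLogChart_carrier.2 (hU j)) hδ (by rw [symplecticLogChart_ρ]; linarith))

/-- **(0.9) on the compact symplectic group `G = Sp(n)`**: `fedM δ U ∈ Sp(n)` for `Sp(n)`-valued matrix families,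
`δ ≤ 1/100` — print's «if 𝐔_j ∈ G, then M({𝐔_j}) ∈ G also. (0.9)» for the tree's construction and the third
classical family. [cite: Balaban1987RG1, (0.9) p.253] -/
theorem fedM_mem_compactSymplectic_of_chart {U : Fin (m + 1) → Matrix (l ⊕ l) (l ⊕ l) ℂ}
    (hU : ∀ j, U j ∈ (compactSymplecticLogChart l).carrier) (hδ : δ ≤ 1 / 100) :
    fedM δ U ∈ (compactSymplecticLogChart l).carrier :=
  fedM_mem_logChart (compactSymplecticLogChart l) (fun _ hg => star_mem_compactSymplecticLogChart hg) hU hδ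
    (by rw [compactSymplecticLogChart_ρ]; linarith)

/-- (0.9) on `Sp(n)` for Federbush's solution: `fedSol W ∈ Sp(n)` for `Sp(n)`-families of radius `δ ≤ 1/100`.
[cite: Balaban1987RG1, (0.9) p.253] -/
theorem fedSol_mem_compactSymplectic_of_chart (hδ : δ ≤ 1 / 100) {W : ι → Matrix (l ⊕ l) (l ⊕ l) ℂ}
    (hWs : ∀ j, W j ∈ (compactSymplecticLogChart l).carrier) (hW : ∀ j, ‖W j - 1‖ ≤ δ) :
    fedSol W ∈ (compactSymplecticLogChart l).carrier :=
  fedSol_mem_logChart (compactSymplecticLogChart l) hδ (by rw [compactSymplecticLogChart_ρ]; linarith) hW hWs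

/-! ### Non-vacuity -/

/-- The constant family at `J ∈ Sp(n)` (not the identity) meets the hypotheses of
`fedM_mem_compactSymplectic_of_chart` with `δ = 0`. [folklore] -/
example : fedM 0 (fun _ : Fin (m + 1) => Matrix.J l ℂ) ∈ (compactSymplecticLogChart l).carrier :=
  fedM_mem_compactSymplectic_of_chart (fun _ => J_mem_compactSymplecticLogChart) (by norm_num)

end FormCorollaries

end FederbushMean

/-! ## §5 The local polar ∕ Cartan form: `Aut(J) → Aut(J) ∩ U(N)`, `Sp(2n, ℂ) → Sp(n)` -/

section Polar

/-- **`Gc = Aut(J)` (`star`-closed case `J̄ J = c·1`): the unitary polar factor of `𝐔 ∈ Aut(J)`, `‖𝐔 − 1‖ ≤ 1/10`,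
lies in `Aut(J) ∩ U(N)`**, `U′ = e^{P/2} ∈ Aut(J)`, and the Cartan generator `A′ ∈ 𝔞𝔲𝔱(J) ∩ 𝔲(N)`
(`LogChartPolar` §2/§4a on the chart `formLogChart J`, whose Lie algebra is closed under `i`). [folklore] -/
theorem polarUnit_mem_formAut {J g : Matrix n n ℂ} {c : ℂ} (hc : c ≠ 0)
    (hJ : conjEntry n J * J = c • (1 : Matrix n n ℂ)) (hgJ : g * J * g.transpose = J) (hg : ‖g - 1‖ ≤ 1 / 10) :
    (polarUnit g ∈ Matrix.unitaryGroup n ℂ ∧ polarUnit g * J * (polarUnit g).transpose = J) ∧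
      polarPos g * J * (polarPos g).transpose = J ∧
      (star (polarGen g) = -polarGen g ∧ polarGen g * J + J * (polarGen g).transpose = 0) := by
  have hstar : ∀ ⦃g : Matrix n n ℂ⦄, g ∈ (formLogChart J).carrier → star g ∈ (formLogChart J).carrier :=
    fun _ hg => star_mem_formLogChart hc hJ hg
  have hI : ∀ ⦃X : Matrix n n ℂ⦄, X ∈ (formLogChart J).lie → Complex.I • X ∈ (formLogChart J).lie :=
    fun _ hX => I_smul_mem_formLogChart_lie hX
  have hgG : g ∈ (formLogChart J).carrier := (mem_formLogChart_carrier).2 hgJ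
  have hρ' : 3 * (1 / 10 : ℝ) ≤ (formLogChart J).ρ := by rw [formLogChart_ρ]; norm_num
  exact ⟨⟨polarUnit_mem_unitaryGroup hg,
      (mem_formLogChart_carrier).1 (LogChart.polarUnit_mem hstar hgG hg le_rfl hρ')⟩,
    (mem_formLogChart_carrier).1 (LogChart.polarPos_mem hstar hgG hg le_rfl hρ'),
    ⟨star_polarGen hg, (mem_formLogChart_lie).1 (LogChart.polarGen_mem_lie hstar hI hgG hg le_rfl hρ')⟩⟩

variable {l : Type*} [Fintype l] [DecidableEq l]

/-- **`Gc = Sp(2n, ℂ)`, `G = Sp(n)`: for `𝐔 ∈ Sp(2n, ℂ)` with `‖𝐔 − 1‖ ≤ 1/10`, the unitary polar factor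
`U = e^{−P/2}𝐔` lies in `Sp(n)`, `U′ = e^{P/2} ∈ Sp(2n, ℂ)`, and `A′ = −(i/2)P ∈ 𝔰𝔭(n) = 𝔲(2n) ∩ 𝔰𝔭(2n, ℂ)`** —
print's «𝐔 = U′U, where U ∈ G and U′ = exp iA′, A′ ∈ 𝐠ᶜ» (p. 252) for the tree's equation-defined `Sp(2n, ℂ)`,
near the identity. [folklore] -/
theorem polarUnit_mem_compactSymplectic {g : Matrix (l ⊕ l) (l ⊕ l) ℂ} (hgS : g ∈ Matrix.symplecticGroup l ℂ)
    (hg : ‖g - 1‖ ≤ 1 / 10) :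
    polarUnit g ∈ (compactSymplecticLogChart l).carrier ∧ polarPos g ∈ Matrix.symplecticGroup l ℂ ∧
      polarGen g ∈ (compactSymplecticLogChart l).lie := by
  have h := polarUnit_mem_formAut (by norm_num) conjEntry_J_mul_J (SymplecticGroup.mem_iff.1 hgS) hg
  refine ⟨mem_compactSymplecticLogChart_carrier.2 ⟨h.1.1, SymplecticGroup.mem_iff.2 h.1.2⟩,
    SymplecticGroup.mem_iff.2 h.2.1, mem_compactSymplecticLogChart_lie.2 h.2.2⟩

/-- The polar form `𝐔 = U′U` on `Sp(2n, ℂ)` with both memberships, as an existence statement. [folklore] -/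
theorem exists_polar_symplectic {g : Matrix (l ⊕ l) (l ⊕ l) ℂ} (hgS : g ∈ Matrix.symplecticGroup l ℂ)
    (hg : ‖g - 1‖ ≤ 1 / 10) :
    ∃ A U : Matrix (l ⊕ l) (l ⊕ l) ℂ, A ∈ (compactSymplecticLogChart l).lie ∧
      U ∈ (compactSymplecticLogChart l).carrier ∧ g = exp (Complex.I • A) * U :=
  ⟨polarGen g, polarUnit g, (polarUnit_mem_compactSymplectic hgS hg).2.2,
    (polarUnit_mem_compactSymplectic hgS hg).1, by
      rw [← polarPos_eq_exp_I_smul_polarGen]; exact (polarPos_mul_polarUnit g).symm⟩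

/-! ### Non-vacuity -/

/-- `J ∈ Sp(2n, ℂ)` with `‖J − 1‖ ≤ 1/10` is FALSE (`J` is far from `1`), but `1 ∈ Sp(2n, ℂ)` meets the hypotheses;
the content of `polarUnit_mem_compactSymplectic` is the membership, exercised here at `g = 1`. [folklore] -/
example : polarUnit (1 : Matrix (l ⊕ l) (l ⊕ l) ℂ) ∈ (compactSymplecticLogChart l).carrier :=
  (polarUnit_mem_compactSymplectic (Matrix.symplecticGroup l ℂ).one_mem (by rw [sub_self, norm_zero]; norm_num)).1

end Polar

end Literature.MathematicalPhysics.QuantumFieldTheory.Balaban1983to89
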